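import Summits.ValiantsHypothesis.ValiantsHypothesis.Theorems.KPlusLogSqLawTropicalGradedWalkPotM
import Summits.ValiantsHypothesis.ValiantsHypothesis.Theorems.KPlusLogSqLawTropicalGradedWalkDomXGlue1

/-!
# Route «KPlusLogSqLaw» — GRW-lite (all-`m` `K = 4` family), dominance certificate of the LAST PHASE `w = m` — glue, part 1: structure lemmas

HONEST FRAMING.  Helper file of the chain `--supports` the crux `Summit.ValiantsHypothesis.ValiantsHypothesis.Theses.KPlusLogSqLaw.TropicalB`
(item `stmt-ValiantsHypothesis-19771`, route `KPlusLogSqLaw`; cell `pub-symmetroid`, seat val-sym-trop-p3 g15, 2026-08-29).  Nothing here bears on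
`TropicalB` in its window, `WeakLifting`, the doors, `MatrixDescartes` or `VP ≠ VNP` (census-side construction).

CONTENT.  The combinatorial interface of the phase-`m` states of the design (`…GradedWalkDefs`) used by the slack glue (`…DomMGlue2…`): the
rotation of phase `m` is trivial (`rot_top`); the VALUE FORMULA of the deep-walk cycle `cyc n u t` (`cyc_val`: the rows `u − t, …, u − 1` move up
by one, row `u` goes to `u − t`, all other rows are fixed — by induction on `t` from the swap recursion) and hence of the permutation of the state
`(m, u, t)` (`perm_M_val`, with the three regimes `perm_M_blk` / `perm_M_conn` / `perm_M_fix`, and `perm_MT_val` for the tops); the class maps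
(`lam_M`, `lam_MT`); the regimes of the scale-`6` potentials `UMX` / `UMD` / `UMT` (`UMX_lo/mid/hi`, `UMD_lo/hi'`, `UMT_lo/hi'`, the last two
including the junction rows `a = u`, `a = t` where both closed forms agree: `bDhi_self`, `bThi_self`); and the packaging lemmas `slack6_of`,
`slack6_of0` of a slack inequality at scale `6`; the presence of the intended incidences (`present_MX`, `present_MT`, with `ee_upper_one_ne`).
-/

set_option linter.dupNamespace false
set_option autoImplicit false

namespace Summit.ValiantsHypothesis.ValiantsHypothesis.Theorems.LacunarySymmetroidMatrixDescartes.TropicalCensus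

namespace GradedWalk

variable (n : ℕ)

/-! ### packaging -/

/-- packaging of a scale-`6` slack inequality. -/
theorem slack6_of {X X' Y Z D T T' : ℤ} (hF : 6 * X' + 6 ≤ D + 6 * T') (hX : X = X') (hT : T = T') (hY : Y - Z = D) :
    6 * X < Y + (6 * T - Z) := by
  subst hX; subst hT; linarith

/-- packaging of a scale-`6` slack inequality, rival in the intended row. -/
theorem slack6_of0 {X X' Y Z T T' : ℤ} (hF : 6 * X' + 6 ≤ 6 * T') (hX : X = X') (hT : T = T') (hY : Y - Z = 0) :
    6 * X < Y + (6 * T - Z) := by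
  subst hX; subst hT; linarith

/-! ### the permutations of phase `m` -/

/-- the rotation of phase `m` is the identity. -/
theorem rot_top : rot n (n + 1) = 1 := by
  unfold rot; simp

/-- value of a transposition on `Fin (n + 1)`. -/
theorem swap_val (p q y : Fin (n + 1)) :
    ((Equiv.swap p q y : Fin (n + 1)) : ℕ) = if (y : ℕ) = p then (q : ℕ) else if (y : ℕ) = q then (p : ℕ) else (y : ℕ) := by
  rw [Equiv.swap_apply_def]
  by_cases h1 : y = p
  · subst h1; simp
  · have h1' : (y : ℕ) ≠ (p : ℕ) := fun h => h1 (Fin.ext h)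
    rw [if_neg h1, if_neg h1']
    by_cases h2 : y = q
    · subst h2; simp
    · have h2' : (y : ℕ) ≠ (q : ℕ) := fun h => h2 (Fin.ext h)
      rw [if_neg h2, if_neg h2']

/-- value formula of the deep-walk cycle: rows `u − t, …, u − 1` move up by one, row `u` goes to `u − t`, the other rows are fixed. -/
theorem cyc_val (u : ℕ) (hun : u ≤ n) : ∀ (t : ℕ), t ≤ u → ∀ x : Fin (n + 1),
    ((cyc n u t x : Fin (n + 1)) : ℕ) =
      if u - t ≤ (x : ℕ) ∧ (x : ℕ) < u then (x : ℕ) + 1 else if (x : ℕ) = u then u - t else (x : ℕ)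
  | 0, _, x => by
      simp only [cyc, Equiv.Perm.coe_one, id_eq, Nat.sub_zero]
      split_ifs with h1 h2 <;> omega
  | t + 1, ht, x => by
      have ih := cyc_val u hun t (by omega) x
      have hx : (x : ℕ) ≤ n := Nat.lt_succ_iff.mp x.isLt
      rw [cyc, Equiv.Perm.mul_apply, swap_val, ih]
      have hp : (u - (t + 1)) % (n + 1) = u - (t + 1) := Nat.mod_eq_of_lt (by omega)
      have hq : (u - t) % (n + 1) = u - t := Nat.mod_eq_of_lt (by omega)
      simp only [hp, hq]
      split_ifs <;> omega

/-- value formula of the permutation of the phase-`m` state `(m, u, t)`, `t ≤ u < m`. -/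
theorem perm_M_val {u t : ℕ} (hun : u ≤ n) (htu : t ≤ u) (b : Fin (n + 1)) :
    ((perm n (n + 1) u t b : Fin (n + 1)) : ℕ) =
      if u - t ≤ (b : ℕ) ∧ (b : ℕ) < u then (b : ℕ) + 1 else if (b : ℕ) = u then u - t else (b : ℕ) := by
  unfold perm
  rw [if_neg (by omega), show n + 1 - (n + 1) + u = u by omega, rot_top, mul_one]
  exact cyc_val n u hun t htu b

/-- block columns `u − t ≤ b < u`: one row up. -/
theorem perm_M_blk {u t : ℕ} (hun : u ≤ n) (htu : t ≤ u) {b : Fin (n + 1)} (h1 : u ≤ (b : ℕ) + t) (h2 : (b : ℕ) < u) :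
    ((perm n (n + 1) u t b : Fin (n + 1)) : ℕ) = (b : ℕ) + 1 := by
  rw [perm_M_val n hun htu, if_pos ⟨by omega, h2⟩]

/-- the connector column `b = u` (`1 ≤ t`): row `u − t`. -/
theorem perm_M_conn {u t : ℕ} (hun : u ≤ n) (htu : t ≤ u) {b : Fin (n + 1)} (h : (b : ℕ) = u) :
    ((perm n (n + 1) u t b : Fin (n + 1)) : ℕ) = u - t := by
  rw [perm_M_val n hun htu, if_neg (by omega), if_pos h]

/-- the other columns are diagonal. -/
theorem perm_M_fix {u t : ℕ} (hun : u ≤ n) (htu : t ≤ u) {b : Fin (n + 1)} (h : (b : ℕ) + t < u ∨ u < (b : ℕ)) :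
    perm n (n + 1) u t b = b := by
  apply Fin.ext
  rw [perm_M_val n hun htu, if_neg (by omega), if_neg (by omega)]

/-- the top states of phase `m` are diagonal. -/
theorem perm_MT (t : ℕ) (b : Fin (n + 1)) : perm n (n + 1) (n + 1) t b = b := by
  unfold perm; rw [if_pos rfl, rot_top]; rfl

/-- class map of the phase-`m` state `(m, u, t)`, `u < m`. -/
theorem lam_M {u t : ℕ} (hun : u ≤ n) (b : Fin (n + 1)) :
    lam n (n + 1) u t b = if (b : ℕ) + t < u then 2 else if (b : ℕ) < u then 3 else 1 := by
  have hb : (b : ℕ) ≤ n := Nat.lt_succ_iff.mp b.isLt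
  unfold lam
  rw [if_neg (by omega), if_neg (by omega)]

/-- class map of the top state `(m, m, t)`. -/
theorem lam_MT (t : ℕ) (b : Fin (n + 1)) : lam n (n + 1) (n + 1) t b = if (b : ℕ) < t then 3 else 2 := by
  have hb : (b : ℕ) ≤ n := Nat.lt_succ_iff.mp b.isLt
  unfold lam
  rw [if_neg (by omega), if_pos rfl]

/-! ### regimes of the potentials -/

/-- excursion potential, rows `a ≤ u − t`. -/
theorem UMX_lo {u t a : ℕ} (h : a + t ≤ u) : UMX n u t a = 6 * (gG n * thM n u t * (((a) : ℕ) : ℤ)) + bXlo n u t (a) := by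
  unfold UMX; rw [bX_lo n h]
/-- excursion potential, rows `u − t < a ≤ u`. -/
theorem UMX_mid {u t a : ℕ} (h1 : ¬ a + t ≤ u) (h2 : a ≤ u) : UMX n u t a = 6 * (gG n * thM n u t * (((a) : ℕ) : ℤ)) + bXmid n u t (a) := by
  unfold UMX; rw [bX_mid n h1 h2]
/-- excursion potential, rows `a > u`. -/
theorem UMX_hi {u t a : ℕ} (h : ¬ a ≤ u) : UMX n u t a = 6 * (gG n * thM n u t * (((a) : ℕ) : ℤ)) + bXhi n u t (a) := by
  unfold UMX; rw [bX_hi n h]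
/-- the two closed forms of the diagonal-state bend agree at the junction row `a = u`. -/
theorem bDhi_self (u : ℕ) : bDhi n u u = bDlo n u u := by
  unfold bDhi bDlo; ring
/-- diagonal-state potential, rows `a ≤ u`. -/
theorem UMD_lo {u a : ℕ} (h : a ≤ u) : UMD n u a = 6 * (gG n * thM n u 0 * (((a) : ℕ) : ℤ)) + bDlo n u (a) := by
  unfold UMD; rw [bD_lo n h]
/-- diagonal-state potential, rows `a ≥ u` (including the junction row). -/
theorem UMD_hi' {u a : ℕ} (h : u ≤ a) : UMD n u a = 6 * (gG n * thM n u 0 * (((a) : ℕ) : ℤ)) + bDhi n u (a) := by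
  unfold UMD
  rcases Nat.eq_or_lt_of_le h with h1 | h1
  · subst h1; rw [bD_lo n le_rfl, bDhi_self]
  · rw [bD_hi n (by omega)]
/-- the two closed forms of the top-state bend agree at the junction row `a = t`. -/
theorem bThi_self (t : ℕ) : bThi n t t = bTlo n t t := by
  unfold bThi bTlo; ring
/-- top-state potential, rows `a ≤ t`. -/
theorem UMT_lo {t a : ℕ} (h : a ≤ t) : UMT n t a = 6 * (gG n * thMT n t * (((a) : ℕ) : ℤ)) + bTlo n t (a) := by
  unfold UMT; rw [bT_lo n h]
/-- top-state potential, rows `a ≥ t` (including the junction row). -/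
theorem UMT_hi' {t a : ℕ} (h : t ≤ a) : UMT n t a = 6 * (gG n * thMT n t * (((a) : ℕ) : ℤ)) + bThi n t (a) := by
  unfold UMT
  rcases Nat.eq_or_lt_of_le h with h1 | h1
  · subst h1; rw [bT_lo n le_rfl, bThi_self]
  · rw [bT_hi n (by omega)]

/-! ### presence of the intended incidences -/

/-- an upper cell with class `1` (a connector) is present. -/
theorem ee_upper_one_ne {a b : Fin (n + 1)} (h : (a : ℕ) < (b : ℕ)) : ee n a b 1 ≠ 0 := by
  unfold ee; rw [if_neg (by omega), if_neg (by omega)]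
  simp only [Fin.val_one]
  split_ifs <;> first | exact pow_ne_zero _ (by norm_num) | norm_num

/-- the intended incidences of the phase-`m` state `(m, u, t)`, `t ≤ u < m`, are present. -/
theorem present_MX (u t : ℕ) (htu : t ≤ u) (hun : u ≤ n) (i : Fin (n + 1)) :
    ee n (perm n (n + 1) u t i) i (lam n (n + 1) u t i) ≠ 0 := by
  rw [lam_M n hun]
  by_cases h1 : (i : ℕ) + t < u
  · rw [if_pos h1, perm_M_fix n hun htu (Or.inl h1)]
    exact ee_diag_ne n rfl 2 (by decide)
  · rw [if_neg h1]
    by_cases h2 : (i : ℕ) < u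
    · rw [if_pos h2]
      have hr := perm_M_blk n hun htu (b := i) (by omega) h2
      exact ee_lower_ne n (show (i : ℕ) < ((perm n (n + 1) u t i : Fin (n + 1)) : ℕ) by omega) 3 (by decide)
    · rw [if_neg h2]
      by_cases h3 : (i : ℕ) = u
      · have hr := perm_M_conn n hun htu (b := i) h3
        rcases Nat.lt_or_ge (((perm n (n + 1) u t i : Fin (n + 1)) : ℕ)) (i : ℕ) with hlt | hge
        · exact ee_upper_one_ne n hlt
        · exact ee_diag_ne n (show ((perm n (n + 1) u t i : Fin (n + 1)) : ℕ) = (i : ℕ) by omega) 1 (by decide)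
      · rw [perm_M_fix n hun htu (Or.inr (by omega))]
        exact ee_diag_ne n rfl 1 (by decide)

/-- the intended incidences of the top state `(m, m, t)` are present. -/
theorem present_MT (t : ℕ) (i : Fin (n + 1)) :
    ee n (perm n (n + 1) (n + 1) t i) i (lam n (n + 1) (n + 1) t i) ≠ 0 := by
  rw [lam_MT, perm_MT]
  split_ifs
  · exact ee_diag_ne n rfl 3 (by decide)
  · exact ee_diag_ne n rfl 2 (by decide)

end GradedWalk

end Summit.ValiantsHypothesis.ValiantsHypothesis.Theorems.LacunarySymmetroidMatrixDescartes.TropicalCensus
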